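import Literature.Claims.NS.Hlomuka2010
import Summits.NavierStokesRegularity.NavierStokesRegularity.Theorems.SoloRefutePanPan2025
import Summits.NavierStokesRegularity.NavierStokesRegularity.Theorems.SoloRefuteZgurovskyKasyanov2012
import HarnessLib

/-!
# C105 `Hlomuka2010` — refutation certificate against `Literature.Claims.NS.Hlomuka2010` (cell
`ns-claims`, D-0090; refuter of record ns-claims-refuter-1; skeleton typist-6 g3 p491092)

Text of record: J. Hlomuka, Far East J. Appl. Math. 40 (2) (2010) 153–163 (print p.N = PDF p.N−152).
First failing step of the printed chain (dependency order Step 1 → … → Step 7): **Proposition 7.3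
p.160, first sentence of the proof, «Since Ω ⊂ R³ (according to Option A in [2]), Θ is finite
dimensional»**, typed as `Step3_Prop73_finiteDim` (every member of `Θ` is, on `[0,T] × Ω`, a
combination of finitely many fixed fields). Every compactness statement downstream (Prop 7.3/7.4,
the Leray–Schauder step of Main Theorem 8.2) rests on it.

* `not_Step3_Prop73_finiteDim` — countermodel: `Ω` = the open unit ball (a `C^∞` bounded
  domain, `isSmoothDomain_Ω`), `T = 1`, `v⁰ ≡ 0`; the members `v_k(t,x) = ψ_k(t)·w(x)` of
  `Θ`, where `w` is the compactly supported divergence-free swirl of the C97 certificate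
  (`PanPan2025.ppSwirl`, support in the closed unit ball, so `w = 0` on `∂Ω`) and `ψ_0,…,ψ_n`
  are smooth time bumps with pairwise disjoint supports inside `(0,1)`. If `Θ` lay in the span
  of `n` fields, the `n+1` coefficient vectors in `ℝⁿ` would be linearly dependent; evaluating
  the dependence relation at a bump centre and at a point where `w ≠ 0` gives `0 ≠ 0`.
* `not_Step5_Thm82_exists` — downstream record (Main Theorem 8.2, existence sentence p.161): with
  the text's own (16)/(21) substituted, (22) reads `v = αv` on `[0,T] × Ω`, i.e. `v ≡ 0` there
  (`eq22_iff_zero`), so `v(0,·) = v⁰` fails for the admissible datum `v⁰ = w ≢ 0`.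

Nothing here decides Clay (A). WHAT THIS IS NOT: not a claim about NS regularity or blow-up; not a
claim about any author beyond the typed locator.
-/

set_option linter.dupNamespace false

open Set Metric MeasureTheory Function
open scoped ContDiff

namespace Summit.NavierStokesRegularity.NavierStokesRegularity.Theorems.Hlomuka2010

open Literature.Analysis.FluidPDE Literature.Claims.NS.Hlomuka2010
open Summit.NavierStokesRegularity.NavierStokesRegularity.Theorems.PanPan2025 (ppSwirl ppCut ppRot
  ppRot_apply contDiff_ppSwirl isDivFree_ppSwirl differentiable_ppSwirl)
open Literature.Claims.NS.ZgurovskyKasyanov2012 (IsSmoothDomain)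
open Summit.NavierStokesRegularity.NavierStokesRegularity.Theorems.ZgurovskyKasyanov2012 (Ω
  isSmoothDomain_Ω)

noncomputable section

/-! ## The domain, the datum and the swirl -/

/-- The domain of the countermodel is the open unit ball `Ω = B(0,1)` of the C-ZK certificate
(`ZgurovskyKasyanov2012.Ω`, with `isSmoothDomain_Ω`). [folklore] -/
theorem hlΩ_eq : Ω = ball (0 : E3) 1 := rfl

/-- `Ω` is non-empty. [folklore] -/
theorem hlΩ_nonempty : Ω.Nonempty := ⟨0, by rw [hlΩ_eq]; exact mem_ball_self one_pos⟩

/-- On the boundary sphere the swirl vanishes (`‖x‖ = 1 ⇒ e^{−1/(1−‖x‖²)} = 0`). [folklore] -/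
theorem ppSwirl_eq_zero_of_norm {x : E3} (hx : 1 ≤ ‖x‖) : ppSwirl x = 0 := by
  have hle : 1 - ‖x‖ ^ 2 ≤ 0 := by nlinarith
  simp [ppSwirl, ppCut, expNegInvGlue.zero_of_nonpos hle]

/-- The swirl vanishes on `∂Ω`. [folklore] -/
theorem ppSwirl_eq_zero_of_frontier {x : E3} (hx : x ∈ frontier Ω) : ppSwirl x = 0 := by
  rw [hlΩ_eq, frontier_ball (0 : E3) one_ne_zero, mem_sphere_zero_iff_norm] at hx
  exact ppSwirl_eq_zero_of_norm hx.ge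

/-- Divergence of a constant multiple: `div (a·w) = a · div w`. [folklore] -/
theorem divergence_const_smul (a : ℝ) {w : E3 → E3} (hw : Differentiable ℝ w) (x : E3) :
    VectorCalculus.divergence (fun y => a • w y) x = a * VectorCalculus.divergence w x := by
  unfold VectorCalculus.divergence
  rw [show (fun y => a • w y) = a • w from rfl, fderiv_const_smul (hw x),
    ContinuousLinearMap.toLinearMap_smul, map_smul, smul_eq_mul]

/-- The zero field is an admissible datum. [folklore] -/
theorem isDatum_zero : IsDatum Ω (fun _ => (0 : E3)) := by
  refine ⟨contDiff_const, fun x _ => ?_, fun _ _ => rfl⟩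
  unfold VectorCalculus.divergence
  simp

/-- The swirl is an admissible datum on the ball. [folklore] -/
theorem isDatum_ppSwirl : IsDatum Ω ppSwirl :=
  ⟨contDiff_ppSwirl, fun x _ => isDivFree_ppSwirl x, fun _ hx => ppSwirl_eq_zero_of_frontier hx⟩

/-- The test point `x₀ = ½e₁ ∈ Ω`. [folklore] -/
def hlX0 : E3 := EuclideanSpace.single 1 (1 / 2 : ℝ)

/-- `‖x₀‖ = ½`. [folklore] -/
theorem norm_hlX0 : ‖hlX0‖ = 1 / 2 := by
  norm_num [hlX0]

/-- `x₀ ∈ Ω`. [folklore] -/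
theorem hlX0_mem : hlX0 ∈ Ω := by
  rw [hlΩ_eq, mem_ball_zero_iff, norm_hlX0]
  norm_num

/-- `w(x₀) ≠ 0` (its `e₀`-component is `½·e^{−4/3}`). [folklore] -/
theorem ppSwirl_hlX0_ne_zero : ppSwirl hlX0 ≠ 0 := by
  intro h
  have h0 := congrArg (fun v : E3 => v 0) h
  have hc : 0 < ppCut hlX0 := by
    rw [ppCut, norm_hlX0]
    exact expNegInvGlue.pos_of_pos (by norm_num)
  simp [ppSwirl, ppRot_apply, hlX0, PanPan2025.bv] at h0
  exact hc.ne' (by simpa [hlX0] using h0)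

/-! ## Disjoint time bumps -/

/-- Centre of the `k`-th bump: `c_k = (k+1)/(n+2) ∈ (0,1)`. [folklore] -/
def hlCtr (n : ℕ) (k : Fin (n + 1)) : ℝ := ((k : ℕ) + 1) / ((n : ℝ) + 2)

/-- The `k`-th time bump: `= 1` near `c_k`, `= 0` at distance `≥ 1/(4(n+2))`. [folklore] -/
def hlBump (n : ℕ) (k : Fin (n + 1)) : ContDiffBump (hlCtr n k) :=
  ⟨1 / (8 * ((n : ℝ) + 2)), 1 / (4 * ((n : ℝ) + 2)), by positivity, by
    rw [one_div_lt_one_div (by positivity) (by positivity)]; nlinarith⟩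

/-- The bump as a function `ψ_k : ℝ → ℝ`. [folklore] -/
def hlPsi (n : ℕ) (k : Fin (n + 1)) : ℝ → ℝ := hlBump n k

/-- `ψ_k` is smooth. [folklore] -/
theorem contDiff_hlPsi (n : ℕ) (k : Fin (n + 1)) : ContDiff ℝ ∞ (hlPsi n k) := (hlBump n k).contDiff

/-- `ψ_k(c_k) = 1`. [folklore] -/
theorem hlPsi_self (n : ℕ) (k : Fin (n + 1)) : hlPsi n k (hlCtr n k) = 1 :=
  (hlBump n k).one_of_mem_closedBall (mem_closedBall_self (hlBump n k).rIn_pos.le)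

/-- Distinct centres are `≥ 1/(n+2)` apart. [folklore] -/
theorem hlCtr_dist {n : ℕ} {j k : Fin (n + 1)} (h : j ≠ k) :
    1 / ((n : ℝ) + 2) ≤ dist (hlCtr n j) (hlCtr n k) := by
  have hn : (0 : ℝ) < (n : ℝ) + 2 := by positivity
  rw [Real.dist_eq, hlCtr, hlCtr, ← sub_div, abs_div, abs_of_pos hn, div_le_div_iff_of_pos_right hn]
  have hjk : (j : ℕ) ≠ (k : ℕ) := fun e => h (Fin.ext e)
  rcases Nat.lt_or_gt_of_ne hjk with hlt | hlt
  · have : ((j : ℕ) : ℝ) + 1 ≤ ((k : ℕ) : ℝ) := by exact_mod_cast hlt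
    rw [abs_sub_comm, abs_of_nonneg (by linarith)]
    linarith
  · have : ((k : ℕ) : ℝ) + 1 ≤ ((j : ℕ) : ℝ) := by exact_mod_cast hlt
    rw [abs_of_nonneg (by linarith)]
    linarith

/-- `ψ_k(c_j) = 0` for `j ≠ k`. [folklore] -/
theorem hlPsi_other {n : ℕ} {j k : Fin (n + 1)} (h : j ≠ k) : hlPsi n k (hlCtr n j) = 0 := by
  apply (hlBump n k).zero_of_le_dist
  have hn : (0 : ℝ) < (n : ℝ) + 2 := by positivity
  calc (hlBump n k).rOut = 1 / (4 * ((n : ℝ) + 2)) := rfl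
    _ ≤ 1 / ((n : ℝ) + 2) := by
        rw [one_div_le_one_div (by positivity) hn]; linarith
    _ ≤ dist (hlCtr n j) (hlCtr n k) := hlCtr_dist h

/-- `c_k ∈ [0,1]`. [folklore] -/
theorem hlCtr_mem (n : ℕ) (k : Fin (n + 1)) : hlCtr n k ∈ Icc (0 : ℝ) 1 := by
  have hn : (0 : ℝ) < (n : ℝ) + 2 := by positivity
  have hk : ((k : ℕ) : ℝ) + 1 ≤ (n : ℝ) + 2 := by
    have : (k : ℕ) ≤ n := Nat.lt_succ_iff.mp k.isLt
    have : ((k : ℕ) : ℝ) ≤ n := by exact_mod_cast this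
    linarith
  refine ⟨by unfold hlCtr; positivity, ?_⟩
  rw [hlCtr, div_le_one hn]
  exact hk

/-- `ψ_k(0) = 0`. [folklore] -/
theorem hlPsi_zero (n : ℕ) (k : Fin (n + 1)) : hlPsi n k 0 = 0 := by
  apply (hlBump n k).zero_of_le_dist
  have hn : (0 : ℝ) < (n : ℝ) + 2 := by positivity
  have h1 : 1 / ((n : ℝ) + 2) ≤ hlCtr n k := by
    unfold hlCtr
    rw [div_le_div_iff_of_pos_right hn]
    have : (0 : ℝ) ≤ ((k : ℕ) : ℝ) := by positivity
    linarith
  calc (hlBump n k).rOut = 1 / (4 * ((n : ℝ) + 2)) := rfl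
    _ ≤ 1 / ((n : ℝ) + 2) := by
        rw [one_div_le_one_div (by positivity) hn]; linarith
    _ ≤ hlCtr n k := h1
    _ = dist 0 (hlCtr n k) := by
        rw [Real.dist_eq, zero_sub, abs_neg, abs_of_nonneg (hlCtr_mem n k).1]

/-! ## The members `v_k(t,x) = ψ_k(t)·w(x)` of `Θ` -/

/-- The member `v_k(t,x) = ψ_k(t) · w(x)`. [folklore] -/
def hlMember (n : ℕ) (k : Fin (n + 1)) (t : ℝ) (x : E3) : E3 := hlPsi n k t • ppSwirl x

/-- Each `v_k` lies in `Θ(Ω = ball, T = 1, v⁰ = 0)`. [folklore] -/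
theorem hlMember_inTheta (n : ℕ) (k : Fin (n + 1)) :
    InTheta Ω 1 (fun _ => (0 : E3)) (hlMember n k) := by
  refine ⟨?_, ?_, ?_, ?_⟩
  · have h : ContDiff ℝ ∞ (uncurry (hlMember n k)) :=
      ((contDiff_hlPsi n k).comp contDiff_fst).smul (contDiff_ppSwirl.comp contDiff_snd)
    exact h.contDiffOn
  · intro t _ x hx
    simp [hlMember, ppSwirl_eq_zero_of_frontier hx]
  · intro x _
    simp [hlMember, hlPsi_zero]
  · intro t _ x _
    rw [show hlMember n k t = fun y => hlPsi n k t • ppSwirl y from rfl,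
      divergence_const_smul _ differentiable_ppSwirl, isDivFree_ppSwirl x, mul_zero]

/-! ## The kills -/

/-- **Proposition 7.3 p.160 («Θ is finite dimensional») is false**: on the unit ball with
`v⁰ = 0`, `T = 1`, no finite family spans `Θ` — the members `ψ_k(t)·w(x)` with `n+1` disjoint
time bumps defeat any `n` fields. [cite: Hlomuka2010, Prop 7.3 p.160] -/
theorem not_Step3_Prop73_finiteDim : ¬ Literature.Claims.NS.Hlomuka2010.Step3_Prop73_finiteDim := by
  intro h
  obtain ⟨n, b, hb⟩ := h Ω isSmoothDomain_Ω hlΩ_nonempty 1 one_pos (fun _ => 0) isDatum_zero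
  choose c hc using fun k : Fin (n + 1) => hb (hlMember n k) (hlMember_inTheta n k)
  -- the `n+1` coefficient vectors in `ℝⁿ` are linearly dependent
  have hdep : ¬ LinearIndependent ℝ c := by
    intro hli
    have := hli.fintype_card_le_finrank
    simp at this
  rw [Fintype.not_linearIndependent_iff] at hdep
  obtain ⟨g, hg, k₀, hk₀⟩ := hdep
  have hgi : ∀ i : Fin n, ∑ k, g k * c k i = 0 := fun i => by
    have := congrArg (fun f : Fin n → ℝ => f i) hg
    simpa [Finset.sum_apply, Pi.smul_apply, smul_eq_mul] using this
  -- the dependence relation, transported to `Θ`, at the point `x₀`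
  have key : ∀ t ∈ Icc (0 : ℝ) 1, (∑ k, g k * hlPsi n k t) • ppSwirl hlX0 = 0 := by
    intro t ht
    calc (∑ k, g k * hlPsi n k t) • ppSwirl hlX0
        = ∑ k, g k • hlMember n k t hlX0 := by
          rw [Finset.sum_smul]
          refine Finset.sum_congr rfl fun k _ => ?_
          rw [hlMember, smul_smul]
      _ = ∑ k, g k • ∑ i, c k i • b i t hlX0 := by
          refine Finset.sum_congr rfl fun k _ => ?_
          rw [hc k t ht hlX0 hlX0_mem]
      _ = ∑ i, (∑ k, g k * c k i) • b i t hlX0 := by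
          simp only [Finset.smul_sum, smul_smul]
          rw [Finset.sum_comm]
          refine Finset.sum_congr rfl fun i _ => ?_
          rw [Finset.sum_smul]
      _ = 0 := by simp [hgi]
  -- evaluate at the centre of the `k₀`-th bump: only `ψ_{k₀}` survives
  have hsum : ∑ k, g k * hlPsi n k (hlCtr n k₀) = g k₀ := by
    rw [Finset.sum_eq_single k₀]
    · rw [hlPsi_self, mul_one]
    · intro k _ hk
      rw [hlPsi_other (Ne.symm hk), mul_zero]
    · intro hk; exact absurd (Finset.mem_univ k₀) hk
  have := key (hlCtr n k₀) (hlCtr_mem n k₀)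
  rw [hsum] at this
  rcases smul_eq_zero.mp this with h0 | h0
  · exact hk₀ h0
  · exact ppSwirl_hlX0_ne_zero h0

/-- **Main Theorem 8.2, existence sentence (p.161), is false as printed**: for the admissible datum
`v⁰ = w` on the unit ball, no member of `Θ` solves (22) — (22) forces `v ≡ 0` on `[0,T] × Ω`
(`eq22_iff_zero`) while `v(0,x₀) = w(x₀) ≠ 0`. Downstream of Prop 7.3.
[cite: Hlomuka2010, Thm 8.2 p.161] -/
theorem not_Step5_Thm82_exists : ¬ Literature.Claims.NS.Hlomuka2010.Step5_Thm82_exists := by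
  intro h
  obtain ⟨v, hv, h22⟩ := h Ω isSmoothDomain_Ω hlΩ_nonempty 1 1 1 one_pos one_pos one_pos
    ppSwirl isDatum_ppSwirl (1 / 2) (by norm_num) (by norm_num)
  have hzero := (eq22_iff_zero (by norm_num : (1 / 2 : ℝ) ≠ 1)).mp h22 0
    ⟨le_rfl, zero_le_one⟩ hlX0 hlX0_mem
  rw [hv.initial hlX0 hlX0_mem] at hzero
  exact ppSwirl_hlX0_ne_zero hzero

end

end Summit.NavierStokesRegularity.NavierStokesRegularity.Theorems.Hlomuka2010
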